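import Literature.Barriers.CriticalPhenomena.PlaquetteWalkHoleRootCutLaw
import HarnessLib

/-!
# Barrier catalogue (SAWScalingLimit): THE CUT CRITERION IS SHARP — box-level biconditionals for the root notch with the corner
cell and for `holeS` with the cell two below the far cell; the first NECESSITY theorems of the cut theory

Leaf of `PlaquetteWalkHoleRootCutLaw` (the one-live-edge criterion `ΩG.WE_eq_excursionWinding_of_under_cut`, its three bent-cut
instances and their boxes `lawL_box_rootS_killSE_h3_not_wound_under` / `…_eastCol_…` / `lawL_box_holeS_farSWS_h3_not_wound_under`
with the over twins; the every-position witness transport `exists_wound_witness_shift` is in its cone). Setting: root plaquette `w`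
rooted at `W`, hole `holeFaceW w = (w.1 − 1, w.2) ∉ D`, far cell `farW w`; in boxes, the `m × n` box minus a cell list `S ∋ h`
(hole `h`, root plaquette `(h.1 + 1, h.2)`, far cell `(h.1 − 1, h.2)`).

The cut theory of the parent decides EMPTINESS of a route from ONE lattice cut with at most one live edge. The venture lane's kit
census (j300087, frame `[0,6]×[−1,5]`) could not separate «empty» from «slow»: its two open under cells `{rootS, K_S1}` and
`{holeS, farSWS}` time out there AND in every larger frame. This file settles both cells IN EVERY BOX, in both directions:

* §1 one more one-live-edge cut, towards the WEST wall: ★★ `ΩG.WE_eq_excursionWinding_of_under_holeS_farSWS_westWall` — hole,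
  `holeS = (w.1 − 1, w.2 − 1)` and `farSWS = (w.1 − 2, w.2 − 2)` absent and no face of `D` in the columns `≤ w.1 − 4` (the far
  cell's outer neighbour `farWW` is in the wall column) ⇒ no wound class-`B2a` UNDER-walk: cut west along the hole's bottom
  (dead), south along `holeS.W` (dead), west along `farSW.S` (dead: the cell below is `farSWS`) and along `pocketSW.S` (the one
  possibly live edge), out through the west wall; over twin `…_of_over_holeN_farNWN_westWall` by the row mirror; boxes
  `lawL_box_holeS_farSWS_westCol_not_wound_under` / `lawL_box_holeN_farNWN_westCol_not_wound_over` (`h.1 = 2`, any `S ∋ h`).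
* §2 FOUR EXPLICIT WOUND WITNESSES (32–34 arcs) from the lane's constructive generator (prefix through the first live edge of the
  tightest cut, excursion around the outside), certified by the kernel at the reference position (`decide`: walk axioms, class
  `B2a`, BOTH freeness classes — every rhombus carries a single arc —, woundness by the odd eastern-ray count) and transported to
  EVERY face list containing a translate of their block: `sharpBlockRK` (under, avoids `rootS`, `K_S1`; cells in `[1,7]×[−2,3]`),
  `sharpBlockHF` (under, avoids `holeS`, `farSWS`; `[0,5]×[−2,3]`), and the row mirrors `sharpBlockRKN` / `sharpBlockHFN` (over).
* §3 ★★★★★ THE BICONDITIONALS (`S ∋ h` any list inside the three-cell set, the two defect cells listed):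
  `lawL_box_rootS_killSE_not_wound_under_iff` — with `2 ≤ h.1`, `h.1 + 4 ≤ m`, `3 ≤ h.2`, `h.2 + 2 ≤ n`: NO wound under-walk
  ⟺ `h.2 = 3 ∨ h.1 + 4 = m` (floor exactly three rows below the hole, or east wall exactly two columns beyond the root
  plaquette); `lawL_box_holeS_farSWS_not_wound_under_iff` — with `2 ≤ h.1`, `h.1 + 3 ≤ m`, `3 ≤ h.2`, `h.2 + 2 ≤ n`: NO wound
  under-walk ⟺ `h.2 = 3 ∨ h.1 = 2`; the over twins `lawL_box_rootN_killNE_not_wound_over_iff` (⟺ `h.2 + 4 = n ∨ h.1 + 4 = m`)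
  and `lawL_box_holeN_farNWN_not_wound_over_iff` (⟺ `h.2 + 4 = n ∨ h.1 = 2`). In words: on these cells the one-live-edge
  criterion is not only sufficient but NECESSARY — the route is empty exactly when some lattice cut from the route's corner has at
  most one live edge, and otherwise carries wound walks of both freeness classes (so neither honeycomb kill holds either,
  `…_not_killed`).

Not in print; venture lane «pcv-sawmu», seat b-step0 gen 30 (generator `HOME/code/step0/g30/gen/wgen.py`, witnesses
`sharp_witnesses.json`).

References: A. Glazman, I. Manolescu, arXiv:1708.00395v3, §1 (Fig. 1, Fig. 2, remark after eq. (1)), §2.1, §4.2 (translation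
invariance, lattice symmetries), Lemma 2.1 [GlazmanManolescu2019]; A. Glazman, Electron. Commun. Probab. 20 (2015) no. 86, Lemma 3.1,
proof pp. 6–7 [Glazman2015WeightedSAW]; R. Courant, H. Robbins, *What is Mathematics?* (1941/1958), Ch. V Appendix §2 (the even–odd
rule) [CourantRobbins1958]; L. V. Ahlfors, *Complex Analysis* (3rd ed., 1979), Ch. 4 §2.1 (index of a point) [AhlforsCA1979].
-/

noncomputable section

open Set Function Complex

namespace Literature.Probability.RandomPlanarGeometry.SAW.YangBaxter

open Real
open Literature.Barriers.CriticalPhenomena.PlaquetteWalk (mirrorRowFace)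

namespace ΩG

variable {D : Set Face} {w : Face}

/-! ## §1 The west-wall cut for `holeS` + `farSWS`, and its over twin -/

/-- ★★ **`holeS` AND THE CELL TWO BELOW THE FAR CELL ABSENT, WEST WALL RIGHT BEHIND `farWW` ⇒ NO WOUND UNDER-WALK.** Hole,
`(w.1 − 1, w.2 − 1)` (`holeS`) and `(w.1 − 2, w.2 − 2)` (`farSWS`) absent, no face of `D` in the columns `≤ w.1 − 4`. Cut from the
lower corner of the root edge: west along the hole's bottom side (dead), south along the west side of `holeS` (dead), west along the
bottom sides of `farSW = (w.1 − 2, w.2 − 1)` (dead: the cell below is `farSWS`) and of `pocketSW = (w.1 − 3, w.2 − 1)` (the one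
possibly live edge), out through the west wall: at most one live edge (`ΩG.WE_eq_excursionWinding_of_under_cut`).
[cite: GlazmanManolescu2019, Lemma 2.1 (statement, "in the form given in [Gl]"), §1 (Fig. 2)]
[cite: Glazman2015WeightedSAW, Lemma 3.1 (proof, pp. 6–7)] [cite: CourantRobbins1958, Ch. V Appendix §2 (the even–odd rule)] -/
theorem WE_eq_excursionWinding_of_under_holeS_farSWS_westWall (hh : holeFaceW w ∉ D)
    (hHS : ((w.1 - 1, w.2 - 1) : Face) ∉ D) (hFS : ((w.1 - 2, w.2 - 2) : Face) ∉ D)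
    (hwest : ∀ f : Face, f ∈ D → w.1 - 3 ≤ f.1)
    (ω : ΩG D (w.side .W) (farW w)) (hr : RootedFace D (w.side .W) (farW w)) (h : ω.IsB2a)
    (hS : ω.2.firstSideG = .S) (θ : ℝ) :
    ω.WE (fun _ => θ) = excursionWinding θ ω.2.firstSideG (ω.z1 hr h) ω.1 := by
  refine WE_eq_excursionWinding_of_under_cut hh
    (q := fun k => if k = 0 then (w.1, w.2) else if k = 1 then (w.1 - 1, w.2) else (w.1 - ((k - 1 : ℕ) : ℤ), w.2 - 1))
    (c := fun k => if k = 0 then (w.1 - 1, w.2) else if k = 1 then (w.1 - 1, w.2 - 1) else (w.1 - k, w.2 - 1))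
    (s := fun k => if k = 1 then Side.W else Side.S) (K := 4)
    (by simp) (fun k hk => ?_) (fun k hk => ?_) (fun k hk => ?_) (Or.inr (Or.inl fun f hf => ?_))
    (fun k k' hkk' hk' => ?_) ω hr h hS θ
  · interval_cases k
    · simpa using segment_cornerPt_west ((w.1, w.2) : ℤ × ℤ)
    · have := segment_cornerPt_south ((w.1 - 1, w.2) : ℤ × ℤ)
      norm_num at this ⊢
      exact this
    · have := segment_cornerPt_west ((w.1 - 1, w.2 - 1) : ℤ × ℤ)
      norm_num at this ⊢
      rw [show w.1 - 1 - 1 = w.1 - 2 by ring] at this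
      exact this
    · have := segment_cornerPt_west ((w.1 - 2, w.2 - 1) : ℤ × ℤ)
      norm_num at this ⊢
      rw [show w.1 - 2 - 1 = w.1 - 3 by ring] at this
      exact this
  · interval_cases k <;> (obtain ⟨a, b⟩ := w; simp [holeFaceW, Face.side])
  · interval_cases k <;> (obtain ⟨a, b⟩ := w; simp [Face.side]; try omega)
  · have := hwest f hf
    simp only [show (4 : ℕ) ≠ 0 from by decide, show (4 : ℕ) ≠ 1 from by decide, if_false,
      show ((4 - 1 : ℕ) : ℤ) = 3 by norm_num]
    omega
  · left
    have hk3 : k < 3 := by omega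
    interval_cases k
    · right
      have e : holeFaceW w = (w.1 - 1, w.2) := by obtain ⟨a, b⟩ := w; simp [holeFaceW]
      simpa [Face.side, MidEdge.faces, e] using hh
    · right; simpa [Face.side, MidEdge.faces] using hHS
    · left
      have e : ((w.1 - 2, w.2 - 2) : Face) = (w.1 - 2, w.2 - 1 - 1) := Prod.ext rfl (by simp only; ring)
      simpa [Face.side, MidEdge.faces, e] using hFS

/-- The reflection in the root row on a cell, in coordinates. [cite: GlazmanManolescu2019, §4.2 (lattice symmetries)] -/
private theorem mirrorRowFace_mkSH (w : Face) (x y : ℤ) : mirrorRowFace w.2 ((x, y) : Face) = (x, 2 * w.2 - y) := by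
  simp [mirrorRowFace]

/-- ★★ **TWIN: `holeN = (w.1 − 1, w.2 + 1)` AND `farNWN = (w.1 − 2, w.2 + 2)` ABSENT, WEST WALL RIGHT BEHIND `farWW` ⇒ NO WOUND
OVER-WALK** (row mirror of `…_of_under_holeS_farSWS_westWall`; the wall hypothesis is mirror-invariant).
[cite: GlazmanManolescu2019, §1 (Fig. 1, Fig. 2), §4.2 (lattice symmetries), Lemma 2.1]
[cite: Glazman2015WeightedSAW, Lemma 3.1 (proof, pp. 6–7)] [cite: CourantRobbins1958, Ch. V Appendix §2 (the even–odd rule)] -/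
theorem WE_eq_excursionWinding_of_over_holeN_farNWN_westWall (hh : holeFaceW w ∉ D)
    (hHN : ((w.1 - 1, w.2 + 1) : Face) ∉ D) (hFN : ((w.1 - 2, w.2 + 2) : Face) ∉ D)
    (hwest : ∀ f : Face, f ∈ D → w.1 - 3 ≤ f.1)
    (ω : ΩG D (w.side .W) (farW w)) (hr : RootedFace D (w.side .W) (farW w)) (h : ω.IsB2a)
    (hN : ω.2.firstSideG = .N) (θ : ℝ) :
    ω.WE (fun _ => θ) = excursionWinding θ ω.2.firstSideG (ω.z1 hr h) ω.1 := by
  by_contra hW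
  have hr' := rootedFace_rowMirrorDom w hr
  have h' := ω.mirrorFar_isB2a hr h
  have hh' : holeFaceW w ∉ rowMirrorDom w D := by rwa [mem_rowMirrorDom, mirrorRowFace_holeFaceW]
  have hHS' : ((w.1 - 1, w.2 - 1) : Face) ∉ rowMirrorDom w D := by
    rw [mem_rowMirrorDom, mirrorRowFace_mkSH, show 2 * w.2 - (w.2 - 1) = w.2 + 1 by ring]; exact hHN
  have hFS' : ((w.1 - 2, w.2 - 2) : Face) ∉ rowMirrorDom w D := by
    rw [mem_rowMirrorDom, mirrorRowFace_mkSH, show 2 * w.2 - (w.2 - 2) = w.2 + 2 by ring]; exact hFN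
  have hwest' : ∀ f : Face, f ∈ rowMirrorDom w D → w.1 - 3 ≤ f.1 := by
    intro f hf
    rw [mem_rowMirrorDom] at hf
    have := hwest _ hf
    obtain ⟨x, y⟩ := f
    rw [mirrorRowFace_mkSH] at this
    exact this
  have hS' : ω.mirrorFar.2.firstSideG = .S := by rw [mirrorFar_firstSideG, hN]; rfl
  exact absurd (WE_eq_excursionWinding_of_under_holeS_farSWS_westWall hh' hHS' hFS' hwest' ω.mirrorFar hr' h' hS' _)
    (ω.mirrorFar_wound hr h hW)

end ΩG

end Literature.Probability.RandomPlanarGeometry.SAW.YangBaxter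

namespace Literature.Barriers.CriticalPhenomena.PlaquetteWalk

open Literature.Probability.RandomPlanarGeometry.SAW.YangBaxter
open Real Complex

/-! ## §1′ Boxes with the hole two columns from the west wall (`h.1 = 2`) -/

section WestBoxes

variable {m n : ℕ} {S : List Face} {h : Face}

/-- ★★★★ **ALL BOXES WITH THE HOLE IN COLUMN `2` (`h.1 = 2`): `holeS = (2, h.2 − 1)` AND `(1, h.2 − 2)` (two below the far cell)
REMOVED ⇒ NO WOUND UNDER-WALK**, any height, whatever else `S ∋ h` removes (far cell kept).
[cite: GlazmanManolescu2019, Lemma 2.1 (statement, "in the form given in [Gl]"), §2.1]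
[cite: Glazman2015WeightedSAW, Lemma 3.1 (proof, pp. 6–7)] [cite: CourantRobbins1958, Ch. V Appendix §2 (the even–odd rule)] -/
theorem lawL_box_holeS_farSWS_westCol_not_wound_under (hW2 : h.1 = 2) (hE : h.1 + 2 ≤ m) (hS0 : 0 ≤ h.2) (hN : h.2 + 1 ≤ n)
    (hh : h ∈ S) (hfS : ((h.1 - 1, h.2) : Face) ∉ S) (hcH : ((h.1, h.2 - 1) : Face) ∈ S)
    (hcF : ((h.1 - 1, h.2 - 2) : Face) ∈ S)
    (ω : ΩG (dom (boxMinus m n S)) (Face.side (h.1 + 1, h.2) .W) (farW (h.1 + 1, h.2))) (hb : ω.IsB2a)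
    (hS' : ω.2.firstSideG = .S) (θ : ℝ) :
    ω.WE (fun _ => θ) = excursionWinding θ ω.2.firstSideG
      (ω.z1 (rootedFace_hroot_boxMinus_of_mem (farW_hroot_mem_boxMinus_of_not_mem (by omega) (by omega) hS0 hN hfS) hh)
        hb) ω.1 := by
  refine ΩG.WE_eq_excursionWinding_of_under_holeS_farSWS_westWall ?_ ?_ ?_ (fun f hf => ?_) ω _ hb hS' θ
  · rw [holeFaceW_hroot]; exact not_mem_dom_boxMinus_of_mem hh
  · have e : ((h.1 + 1 - 1, h.2 - 1) : Face) = (h.1, h.2 - 1) := Prod.ext (by simp only; ring) rfl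
    rw [e]; exact not_mem_dom_boxMinus_of_mem hcH
  · have e : ((h.1 + 1 - 2, h.2 - 2) : Face) = (h.1 - 1, h.2 - 2) := Prod.ext (by simp only; ring) rfl
    rw [e]; exact not_mem_dom_boxMinus_of_mem hcF
  · obtain ⟨hb', -⟩ := mem_dom_boxMinus.1 hf
    simp only at hb' ⊢
    omega

/-- ★★★★ **TWIN (`h.1 = 2`): `holeN = (2, h.2 + 1)` AND `(1, h.2 + 2)` REMOVED ⇒ NO WOUND OVER-WALK**, whatever else `S ∋ h` removes.
[cite: GlazmanManolescu2019, Lemma 2.1 (statement, "in the form given in [Gl]"), §2.1, §4.2]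
[cite: Glazman2015WeightedSAW, Lemma 3.1 (proof, pp. 6–7)] [cite: CourantRobbins1958, Ch. V Appendix §2 (the even–odd rule)] -/
theorem lawL_box_holeN_farNWN_westCol_not_wound_over (hW2 : h.1 = 2) (hE : h.1 + 2 ≤ m) (hS0 : 0 ≤ h.2) (hN : h.2 + 1 ≤ n)
    (hh : h ∈ S) (hfS : ((h.1 - 1, h.2) : Face) ∉ S) (hcH : ((h.1, h.2 + 1) : Face) ∈ S)
    (hcF : ((h.1 - 1, h.2 + 2) : Face) ∈ S)
    (ω : ΩG (dom (boxMinus m n S)) (Face.side (h.1 + 1, h.2) .W) (farW (h.1 + 1, h.2))) (hb : ω.IsB2a)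
    (hN' : ω.2.firstSideG = .N) (θ : ℝ) :
    ω.WE (fun _ => θ) = excursionWinding θ ω.2.firstSideG
      (ω.z1 (rootedFace_hroot_boxMinus_of_mem (farW_hroot_mem_boxMinus_of_not_mem (by omega) (by omega) hS0 hN hfS) hh)
        hb) ω.1 := by
  refine ΩG.WE_eq_excursionWinding_of_over_holeN_farNWN_westWall ?_ ?_ ?_ (fun f hf => ?_) ω _ hb hN' θ
  · rw [holeFaceW_hroot]; exact not_mem_dom_boxMinus_of_mem hh
  · have e : ((h.1 + 1 - 1, h.2 + 1) : Face) = (h.1, h.2 + 1) := Prod.ext (by simp only; ring) rfl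
    rw [e]; exact not_mem_dom_boxMinus_of_mem hcH
  · have e : ((h.1 + 1 - 2, h.2 + 2) : Face) = (h.1 - 1, h.2 + 2) := Prod.ext (by simp only; ring) rfl
    rw [e]; exact not_mem_dom_boxMinus_of_mem hcF
  · obtain ⟨hb', -⟩ := mem_dom_boxMinus.1 hf
    simp only at hb' ⊢
    omega

end WestBoxes

/-! ## §2 Four unmarked wound witnesses (reference root `w42 = (4, 2)`, hole `(3, 2)`, far cell `(2, 2)`), every position -/

section Witnesses

/-- Sharpness witness block `RK`: the 34 cells of an under wound witness that is UNMARKED (every rhombus carries one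
arc: `w₁`-free AND `w₂`-free off the far cell), reference root `(4, 2)`, hole `(3, 2)`, far cell `(2, 2)`, AVOIDING `rootS = (4,1)` and `K_S1 = killSE = (5,0)`;
cells in `[1,7]×[−2,3]` (constructive generator `wgen.py` of the lane, seat b-step0 gen 30).
[cite: GlazmanManolescu2019, §2.1 (finite domains of faces)] -/
def sharpBlockRK42 : List Face :=
  [(1,-2),(1,-1),(1,0),(1,1),(1,2),(2,-2),(2,-1),(2,0),(2,1),(2,2),(2,3),(3,-2),(3,-1),(3,3),(4,-2),(4,-1),(4,2),(4,3),
  (5,-2),(5,-1),(5,1),(5,2),(5,3),(6,-2),(6,-1),(6,0),(6,1),(6,2),(6,3),(7,-2),(7,-1),(7,0),(7,1),(7,2)]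

/-- Its mid-edges (34 arcs). [cite: GlazmanManolescu2019, §1 (definition of the model), Fig. 1] -/
def sharpRKMids : List MidEdge :=
  [.vert 4 2, .vert 5 2, .slant 5 2, .vert 6 1, .slant 6 1, .slant 6 0, .vert 6 (-1), .vert 5 (-1), .vert 4 (-1),
  .vert 3 (-1), .slant 2 0, .slant 2 1, .slant 2 2, .vert 2 2, .slant 1 2, .slant 1 1, .slant 1 0, .slant 1 (-1),
  .vert 2 (-2), .vert 3 (-2), .vert 4 (-2), .vert 5 (-2), .vert 6 (-2), .vert 7 (-2), .slant 7 (-1), .slant 7 0,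
  .slant 7 1, .slant 7 2, .vert 7 2, .slant 6 3, .vert 6 3, .vert 5 3, .vert 4 3, .vert 3 3, .slant 2 3]

/-- The witness as a walk of its block. [cite: GlazmanManolescu2019, §1 (definition of the model), Fig. 1] -/
def sharpRKWalk : YBWalk (dom sharpBlockRK42) (w42.side .W) ((farW w42).side .N) where
  mids := sharpRKMids
  head_eq := by decide
  getLast_eq := by decide
  nodup := by decide
  arc_mem := arc_mem_of_check (by decide)
  isChain := by decide
  noncross := noncross_of_check (by decide)

/-- The labelled witness. [cite: Glazman2015WeightedSAW, Lemma 3.1 (proof, pp. 6–7)] -/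
def ωsharpRK : ΩG (dom sharpBlockRK42) (w42.side .W) (farW w42) := ⟨.N, sharpRKWalk⟩

/-- Certificates: first hit `12`, `34` arcs, no later far-cell arc, first side `S`, `w₁`-free and `w₂`-free off the far
cell, odd eastern-ray count. [cite: Glazman2015WeightedSAW, Lemma 3.1 (proof, pp. 6–7)] [cite: CourantRobbins1958, Ch. V Appendix §2 (the even–odd rule)] -/
theorem ωsharpRK_cert : ωsharpRK.2.firstHitG = 12 ∧ ωsharpRK.2.arcs.length = 34 ∧
    (∀ j < 34, 12 < j → ωsharpRK.2.fc j ≠ farW w42) ∧ ωsharpRK.2.nth 12 = (farW w42).side .S ∧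
    (ωsharpRK.2.W1FreeOff (farW w42) ∧ ωsharpRK.2.W2FreeOff (farW w42)) ∧
    Odd ((Finset.range 22).filter fun j => eastRayB w42 (ωsharpRK.2.nth (12 + j + 1)) = true).card := by
  refine ⟨by decide, by decide, by decide, by decide, ⟨by unfold YBWalk.W1FreeOff; decide, by unfold YBWalk.W2FreeOff; decide⟩,
    by decide⟩

/-- The block at the root plaquette `w`. [cite: GlazmanManolescu2019, §2.1, §4.2 (translation invariance)] -/
def sharpBlockRK (w : Face) : List Face := sharpBlockRK42.map (Face.shiftBy (refShift w))

/-- ★★★ The UNMARKED under wound witness `RK` at EVERY POSITION: any face list containing the translated block carries a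
wound class-`B2a` under-walk at the far cell that is `w₁`-free and `w₂`-free off it (a genuine hexagonal self-avoiding walk at
BOTH hexagonal angles). [cite: GlazmanManolescu2019, §4.2 (translation invariance), Lemma 2.1]
[cite: Glazman2015WeightedSAW, Lemma 3.1 (proof, pp. 6–7)] [cite: CourantRobbins1958, Ch. V Appendix §2 (the even–odd rule)] -/
theorem exists_under_unmarked_of_sharpBlockRK {Dl : List Face} {w : Face} (hB : ∀ c ∈ sharpBlockRK w, c ∈ Dl)
    (hr : RootedFace (dom Dl) (w.side .W) (farW w)) (θ : ℝ) :
    ∃ (ω : ΩG (dom Dl) (w.side .W) (farW w)) (h : ω.IsB2a), ω.2.firstSideG = .S ∧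
      ω.WE (fun _ => θ) ≠ excursionWinding θ ω.2.firstSideG (ω.z1 hr h) ω.1 ∧
        (ω.2.W1FreeOff (farW w) ∧ ω.2.W2FreeOff (farW w)) := by
  have hB₀ := block42_mem_of_block_mem (B := sharpBlockRK42) hB
  obtain ⟨hF, hn, hfc, hnth, hfree, hodd⟩ := ωsharpRK_cert
  let ω₀ : ΩG (dom (Dl.map (Face.shiftBy (-refShift w)))) (w42.side .W) (farW w42) :=
    ⟨.N, sharpRKWalk.mapDomain fun c hc => hB₀ c hc⟩
  have hF' : ω₀.2.firstHitG = 12 := hF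
  have hn' : ω₀.2.arcs.length = 34 := hn
  have h₀ : ω₀.IsB2a := by
    refine ΩG.isB2a_of_forall_fc_ne (by rw [hF', hn']; omega) fun j hj1 hj2 => ?_
    rw [hF'] at hj1
    rw [hn'] at hj2
    exact hfc j hj2 hj1
  have hM : ω₀.Mv = 22 := by unfold ΩG.Mv; rw [hF', hn']
  exact exists_wound_witness_shift (shiftBy_refShift_root w) (shiftBy_refShift_farW w) hr
    (fun γ r => γ.W1FreeOff r ∧ γ.W2FreeOff r)
    (fun hm _ hf => ⟨YBWalk.W1FreeOff_of_mids_shift hm hf.1, YBWalk.W2FreeOff_of_mids_shift hm hf.2⟩) ω₀ h₀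
    (by rw [hF']; exact hnth) hfree (by rw [hM, hF']; exact hodd) θ

/-- Sharpness witness block `HF`: the 32 cells of an under wound witness that is UNMARKED (every rhombus carries one
arc: `w₁`-free AND `w₂`-free off the far cell), reference root `(4, 2)`, hole `(3, 2)`, far cell `(2, 2)`, AVOIDING `holeS = (3,1)` and `farSWS = (2,0)`;
cells in `[0,5]×[−2,3]` (constructive generator `wgen.py` of the lane, seat b-step0 gen 30).
[cite: GlazmanManolescu2019, §2.1 (finite domains of faces)] -/
def sharpBlockHF42 : List Face :=
  [(0,-2),(0,-1),(0,0),(0,1),(0,2),(0,3),(1,-2),(1,-1),(1,0),(1,1),(1,2),(1,3),(2,-2),(2,-1),(2,1),(2,2),(2,3),(3,-2),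
  (3,-1),(3,0),(3,3),(4,-2),(4,-1),(4,0),(4,1),(4,2),(4,3),(5,-1),(5,0),(5,1),(5,2),(5,3)]

/-- Its mid-edges (32 arcs). [cite: GlazmanManolescu2019, §1 (definition of the model), Fig. 1] -/
def sharpHFMids : List MidEdge :=
  [.vert 4 2, .slant 4 2, .slant 4 1, .vert 4 0, .slant 3 0, .vert 3 (-1), .vert 2 (-1), .slant 1 0, .slant 1 1,
  .vert 2 1, .slant 2 2, .vert 2 2, .slant 1 3, .vert 1 3, .slant 0 3, .slant 0 2, .slant 0 1, .slant 0 0,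
  .slant 0 (-1), .vert 1 (-2), .vert 2 (-2), .vert 3 (-2), .vert 4 (-2), .slant 4 (-1), .vert 5 (-1), .slant 5 0,
  .slant 5 1, .slant 5 2, .slant 5 3, .vert 5 3, .vert 4 3, .vert 3 3, .slant 2 3]

/-- The witness as a walk of its block. [cite: GlazmanManolescu2019, §1 (definition of the model), Fig. 1] -/
def sharpHFWalk : YBWalk (dom sharpBlockHF42) (w42.side .W) ((farW w42).side .N) where
  mids := sharpHFMids
  head_eq := by decide
  getLast_eq := by decide
  nodup := by decide
  arc_mem := arc_mem_of_check (by decide)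
  isChain := by decide
  noncross := noncross_of_check (by decide)

/-- The labelled witness. [cite: Glazman2015WeightedSAW, Lemma 3.1 (proof, pp. 6–7)] -/
def ωsharpHF : ΩG (dom sharpBlockHF42) (w42.side .W) (farW w42) := ⟨.N, sharpHFWalk⟩

/-- Certificates: first hit `10`, `32` arcs, no later far-cell arc, first side `S`, `w₁`-free and `w₂`-free off the far
cell, odd eastern-ray count. [cite: Glazman2015WeightedSAW, Lemma 3.1 (proof, pp. 6–7)] [cite: CourantRobbins1958, Ch. V Appendix §2 (the even–odd rule)] -/
theorem ωsharpHF_cert : ωsharpHF.2.firstHitG = 10 ∧ ωsharpHF.2.arcs.length = 32 ∧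
    (∀ j < 32, 10 < j → ωsharpHF.2.fc j ≠ farW w42) ∧ ωsharpHF.2.nth 10 = (farW w42).side .S ∧
    (ωsharpHF.2.W1FreeOff (farW w42) ∧ ωsharpHF.2.W2FreeOff (farW w42)) ∧
    Odd ((Finset.range 22).filter fun j => eastRayB w42 (ωsharpHF.2.nth (10 + j + 1)) = true).card := by
  refine ⟨by decide, by decide, by decide, by decide, ⟨by unfold YBWalk.W1FreeOff; decide, by unfold YBWalk.W2FreeOff; decide⟩,
    by decide⟩

/-- The block at the root plaquette `w`. [cite: GlazmanManolescu2019, §2.1, §4.2 (translation invariance)] -/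
def sharpBlockHF (w : Face) : List Face := sharpBlockHF42.map (Face.shiftBy (refShift w))

/-- ★★★ The UNMARKED under wound witness `HF` at EVERY POSITION: any face list containing the translated block carries a
wound class-`B2a` under-walk at the far cell that is `w₁`-free and `w₂`-free off it (a genuine hexagonal self-avoiding walk at
BOTH hexagonal angles). [cite: GlazmanManolescu2019, §4.2 (translation invariance), Lemma 2.1]
[cite: Glazman2015WeightedSAW, Lemma 3.1 (proof, pp. 6–7)] [cite: CourantRobbins1958, Ch. V Appendix §2 (the even–odd rule)] -/
theorem exists_under_unmarked_of_sharpBlockHF {Dl : List Face} {w : Face} (hB : ∀ c ∈ sharpBlockHF w, c ∈ Dl)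
    (hr : RootedFace (dom Dl) (w.side .W) (farW w)) (θ : ℝ) :
    ∃ (ω : ΩG (dom Dl) (w.side .W) (farW w)) (h : ω.IsB2a), ω.2.firstSideG = .S ∧
      ω.WE (fun _ => θ) ≠ excursionWinding θ ω.2.firstSideG (ω.z1 hr h) ω.1 ∧
        (ω.2.W1FreeOff (farW w) ∧ ω.2.W2FreeOff (farW w)) := by
  have hB₀ := block42_mem_of_block_mem (B := sharpBlockHF42) hB
  obtain ⟨hF, hn, hfc, hnth, hfree, hodd⟩ := ωsharpHF_cert
  let ω₀ : ΩG (dom (Dl.map (Face.shiftBy (-refShift w)))) (w42.side .W) (farW w42) :=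
    ⟨.N, sharpHFWalk.mapDomain fun c hc => hB₀ c hc⟩
  have hF' : ω₀.2.firstHitG = 10 := hF
  have hn' : ω₀.2.arcs.length = 32 := hn
  have h₀ : ω₀.IsB2a := by
    refine ΩG.isB2a_of_forall_fc_ne (by rw [hF', hn']; omega) fun j hj1 hj2 => ?_
    rw [hF'] at hj1
    rw [hn'] at hj2
    exact hfc j hj2 hj1
  have hM : ω₀.Mv = 22 := by unfold ΩG.Mv; rw [hF', hn']
  exact exists_wound_witness_shift (shiftBy_refShift_root w) (shiftBy_refShift_farW w) hr
    (fun γ r => γ.W1FreeOff r ∧ γ.W2FreeOff r)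
    (fun hm _ hf => ⟨YBWalk.W1FreeOff_of_mids_shift hm hf.1, YBWalk.W2FreeOff_of_mids_shift hm hf.2⟩) ω₀ h₀
    (by rw [hF']; exact hnth) hfree (by rw [hM, hF']; exact hodd) θ

/-- Sharpness witness block `RKN`: the 34 cells of an over wound witness that is UNMARKED (every rhombus carries one
arc: `w₁`-free AND `w₂`-free off the far cell), reference root `(4, 2)`, hole `(3, 2)`, far cell `(2, 2)`, AVOIDING `rootN = (4,3)` and `K_N2 = killNE = (5,4)` (row mirror of `RK`);
cells in `[1,7]×[1,6]` (constructive generator `wgen.py` of the lane, seat b-step0 gen 30).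
[cite: GlazmanManolescu2019, §2.1 (finite domains of faces)] -/
def sharpBlockRKN42 : List Face :=
  [(1,2),(1,3),(1,4),(1,5),(1,6),(2,1),(2,2),(2,3),(2,4),(2,5),(2,6),(3,1),(3,5),(3,6),(4,1),(4,2),(4,5),(4,6),(5,1),
  (5,2),(5,3),(5,5),(5,6),(6,1),(6,2),(6,3),(6,4),(6,5),(6,6),(7,2),(7,3),(7,4),(7,5),(7,6)]

/-- Its mid-edges (34 arcs). [cite: GlazmanManolescu2019, §1 (definition of the model), Fig. 1] -/
def sharpRKNMids : List MidEdge :=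
  [.vert 4 2, .vert 5 2, .slant 5 3, .vert 6 3, .slant 6 4, .slant 6 5, .vert 6 5, .vert 5 5, .vert 4 5, .vert 3 5,
  .slant 2 5, .slant 2 4, .slant 2 3, .vert 2 2, .slant 1 3, .slant 1 4, .slant 1 5, .slant 1 6, .vert 2 6, .vert 3 6,
  .vert 4 6, .vert 5 6, .vert 6 6, .vert 7 6, .slant 7 6, .slant 7 5, .slant 7 4, .slant 7 3, .vert 7 2, .slant 6 2,
  .vert 6 1, .vert 5 1, .vert 4 1, .vert 3 1, .slant 2 2]

/-- The witness as a walk of its block. [cite: GlazmanManolescu2019, §1 (definition of the model), Fig. 1] -/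
def sharpRKNWalk : YBWalk (dom sharpBlockRKN42) (w42.side .W) ((farW w42).side .S) where
  mids := sharpRKNMids
  head_eq := by decide
  getLast_eq := by decide
  nodup := by decide
  arc_mem := arc_mem_of_check (by decide)
  isChain := by decide
  noncross := noncross_of_check (by decide)

/-- The labelled witness. [cite: Glazman2015WeightedSAW, Lemma 3.1 (proof, pp. 6–7)] -/
def ωsharpRKN : ΩG (dom sharpBlockRKN42) (w42.side .W) (farW w42) := ⟨.S, sharpRKNWalk⟩

/-- Certificates: first hit `12`, `34` arcs, no later far-cell arc, first side `N`, `w₁`-free and `w₂`-free off the far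
cell, odd eastern-ray count. [cite: Glazman2015WeightedSAW, Lemma 3.1 (proof, pp. 6–7)] [cite: CourantRobbins1958, Ch. V Appendix §2 (the even–odd rule)] -/
theorem ωsharpRKN_cert : ωsharpRKN.2.firstHitG = 12 ∧ ωsharpRKN.2.arcs.length = 34 ∧
    (∀ j < 34, 12 < j → ωsharpRKN.2.fc j ≠ farW w42) ∧ ωsharpRKN.2.nth 12 = (farW w42).side .N ∧
    (ωsharpRKN.2.W1FreeOff (farW w42) ∧ ωsharpRKN.2.W2FreeOff (farW w42)) ∧
    Odd ((Finset.range 22).filter fun j => eastRayB w42 (ωsharpRKN.2.nth (12 + j + 1)) = true).card := by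
  refine ⟨by decide, by decide, by decide, by decide, ⟨by unfold YBWalk.W1FreeOff; decide, by unfold YBWalk.W2FreeOff; decide⟩,
    by decide⟩

/-- The block at the root plaquette `w`. [cite: GlazmanManolescu2019, §2.1, §4.2 (translation invariance)] -/
def sharpBlockRKN (w : Face) : List Face := sharpBlockRKN42.map (Face.shiftBy (refShift w))

/-- ★★★ The UNMARKED over wound witness `RKN` at EVERY POSITION: any face list containing the translated block carries a
wound class-`B2a` over-walk at the far cell that is `w₁`-free and `w₂`-free off it (a genuine hexagonal self-avoiding walk at
BOTH hexagonal angles). [cite: GlazmanManolescu2019, §4.2 (translation invariance), Lemma 2.1]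
[cite: Glazman2015WeightedSAW, Lemma 3.1 (proof, pp. 6–7)] [cite: CourantRobbins1958, Ch. V Appendix §2 (the even–odd rule)] -/
theorem exists_over_unmarked_of_sharpBlockRKN {Dl : List Face} {w : Face} (hB : ∀ c ∈ sharpBlockRKN w, c ∈ Dl)
    (hr : RootedFace (dom Dl) (w.side .W) (farW w)) (θ : ℝ) :
    ∃ (ω : ΩG (dom Dl) (w.side .W) (farW w)) (h : ω.IsB2a), ω.2.firstSideG = .N ∧
      ω.WE (fun _ => θ) ≠ excursionWinding θ ω.2.firstSideG (ω.z1 hr h) ω.1 ∧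
        (ω.2.W1FreeOff (farW w) ∧ ω.2.W2FreeOff (farW w)) := by
  have hB₀ := block42_mem_of_block_mem (B := sharpBlockRKN42) hB
  obtain ⟨hF, hn, hfc, hnth, hfree, hodd⟩ := ωsharpRKN_cert
  let ω₀ : ΩG (dom (Dl.map (Face.shiftBy (-refShift w)))) (w42.side .W) (farW w42) :=
    ⟨.S, sharpRKNWalk.mapDomain fun c hc => hB₀ c hc⟩
  have hF' : ω₀.2.firstHitG = 12 := hF
  have hn' : ω₀.2.arcs.length = 34 := hn
  have h₀ : ω₀.IsB2a := by
    refine ΩG.isB2a_of_forall_fc_ne (by rw [hF', hn']; omega) fun j hj1 hj2 => ?_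
    rw [hF'] at hj1
    rw [hn'] at hj2
    exact hfc j hj2 hj1
  have hM : ω₀.Mv = 22 := by unfold ΩG.Mv; rw [hF', hn']
  exact exists_wound_witness_shift (shiftBy_refShift_root w) (shiftBy_refShift_farW w) hr
    (fun γ r => γ.W1FreeOff r ∧ γ.W2FreeOff r)
    (fun hm _ hf => ⟨YBWalk.W1FreeOff_of_mids_shift hm hf.1, YBWalk.W2FreeOff_of_mids_shift hm hf.2⟩) ω₀ h₀
    (by rw [hF']; exact hnth) hfree (by rw [hM, hF']; exact hodd) θ

/-- Sharpness witness block `HFN`: the 32 cells of an over wound witness that is UNMARKED (every rhombus carries one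
arc: `w₁`-free AND `w₂`-free off the far cell), reference root `(4, 2)`, hole `(3, 2)`, far cell `(2, 2)`, AVOIDING `holeN = (3,3)` and `farNWN = (2,4)` (row mirror of `HF`);
cells in `[0,5]×[1,6]` (constructive generator `wgen.py` of the lane, seat b-step0 gen 30).
[cite: GlazmanManolescu2019, §2.1 (finite domains of faces)] -/
def sharpBlockHFN42 : List Face :=
  [(0,1),(0,2),(0,3),(0,4),(0,5),(0,6),(1,1),(1,2),(1,3),(1,4),(1,5),(1,6),(2,1),(2,2),(2,3),(2,5),(2,6),(3,1),(3,4),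
  (3,5),(3,6),(4,1),(4,2),(4,3),(4,4),(4,5),(4,6),(5,1),(5,2),(5,3),(5,4),(5,5)]

/-- Its mid-edges (32 arcs). [cite: GlazmanManolescu2019, §1 (definition of the model), Fig. 1] -/
def sharpHFNMids : List MidEdge :=
  [.vert 4 2, .slant 4 3, .slant 4 4, .vert 4 4, .slant 3 5, .vert 3 5, .vert 2 5, .slant 1 5, .slant 1 4, .vert 2 3,
  .slant 2 3, .vert 2 2, .slant 1 2, .vert 1 1, .slant 0 2, .slant 0 3, .slant 0 4, .slant 0 5, .slant 0 6, .vert 1 6,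
  .vert 2 6, .vert 3 6, .vert 4 6, .slant 4 6, .vert 5 5, .slant 5 5, .slant 5 4, .slant 5 3, .slant 5 2, .vert 5 1,
  .vert 4 1, .vert 3 1, .slant 2 2]

/-- The witness as a walk of its block. [cite: GlazmanManolescu2019, §1 (definition of the model), Fig. 1] -/
def sharpHFNWalk : YBWalk (dom sharpBlockHFN42) (w42.side .W) ((farW w42).side .S) where
  mids := sharpHFNMids
  head_eq := by decide
  getLast_eq := by decide
  nodup := by decide
  arc_mem := arc_mem_of_check (by decide)
  isChain := by decide
  noncross := noncross_of_check (by decide)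

/-- The labelled witness. [cite: Glazman2015WeightedSAW, Lemma 3.1 (proof, pp. 6–7)] -/
def ωsharpHFN : ΩG (dom sharpBlockHFN42) (w42.side .W) (farW w42) := ⟨.S, sharpHFNWalk⟩

/-- Certificates: first hit `10`, `32` arcs, no later far-cell arc, first side `N`, `w₁`-free and `w₂`-free off the far
cell, odd eastern-ray count. [cite: Glazman2015WeightedSAW, Lemma 3.1 (proof, pp. 6–7)] [cite: CourantRobbins1958, Ch. V Appendix §2 (the even–odd rule)] -/
theorem ωsharpHFN_cert : ωsharpHFN.2.firstHitG = 10 ∧ ωsharpHFN.2.arcs.length = 32 ∧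
    (∀ j < 32, 10 < j → ωsharpHFN.2.fc j ≠ farW w42) ∧ ωsharpHFN.2.nth 10 = (farW w42).side .N ∧
    (ωsharpHFN.2.W1FreeOff (farW w42) ∧ ωsharpHFN.2.W2FreeOff (farW w42)) ∧
    Odd ((Finset.range 22).filter fun j => eastRayB w42 (ωsharpHFN.2.nth (10 + j + 1)) = true).card := by
  refine ⟨by decide, by decide, by decide, by decide, ⟨by unfold YBWalk.W1FreeOff; decide, by unfold YBWalk.W2FreeOff; decide⟩,
    by decide⟩

/-- The block at the root plaquette `w`. [cite: GlazmanManolescu2019, §2.1, §4.2 (translation invariance)] -/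
def sharpBlockHFN (w : Face) : List Face := sharpBlockHFN42.map (Face.shiftBy (refShift w))

/-- ★★★ The UNMARKED over wound witness `HFN` at EVERY POSITION: any face list containing the translated block carries a
wound class-`B2a` over-walk at the far cell that is `w₁`-free and `w₂`-free off it (a genuine hexagonal self-avoiding walk at
BOTH hexagonal angles). [cite: GlazmanManolescu2019, §4.2 (translation invariance), Lemma 2.1]
[cite: Glazman2015WeightedSAW, Lemma 3.1 (proof, pp. 6–7)] [cite: CourantRobbins1958, Ch. V Appendix §2 (the even–odd rule)] -/
theorem exists_over_unmarked_of_sharpBlockHFN {Dl : List Face} {w : Face} (hB : ∀ c ∈ sharpBlockHFN w, c ∈ Dl)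
    (hr : RootedFace (dom Dl) (w.side .W) (farW w)) (θ : ℝ) :
    ∃ (ω : ΩG (dom Dl) (w.side .W) (farW w)) (h : ω.IsB2a), ω.2.firstSideG = .N ∧
      ω.WE (fun _ => θ) ≠ excursionWinding θ ω.2.firstSideG (ω.z1 hr h) ω.1 ∧
        (ω.2.W1FreeOff (farW w) ∧ ω.2.W2FreeOff (farW w)) := by
  have hB₀ := block42_mem_of_block_mem (B := sharpBlockHFN42) hB
  obtain ⟨hF, hn, hfc, hnth, hfree, hodd⟩ := ωsharpHFN_cert
  let ω₀ : ΩG (dom (Dl.map (Face.shiftBy (-refShift w)))) (w42.side .W) (farW w42) :=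
    ⟨.S, sharpHFNWalk.mapDomain fun c hc => hB₀ c hc⟩
  have hF' : ω₀.2.firstHitG = 10 := hF
  have hn' : ω₀.2.arcs.length = 32 := hn
  have h₀ : ω₀.IsB2a := by
    refine ΩG.isB2a_of_forall_fc_ne (by rw [hF', hn']; omega) fun j hj1 hj2 => ?_
    rw [hF'] at hj1
    rw [hn'] at hj2
    exact hfc j hj2 hj1
  have hM : ω₀.Mv = 22 := by unfold ΩG.Mv; rw [hF', hn']
  exact exists_wound_witness_shift (shiftBy_refShift_root w) (shiftBy_refShift_farW w) hr
    (fun γ r => γ.W1FreeOff r ∧ γ.W2FreeOff r)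
    (fun hm _ hf => ⟨YBWalk.W1FreeOff_of_mids_shift hm hf.1, YBWalk.W2FreeOff_of_mids_shift hm hf.2⟩) ω₀ h₀
    (by rw [hF']; exact hnth) hfree (by rw [hM, hF']; exact hodd) θ


end Witnesses

/-! ## §3 The biconditionals: the one-live-edge criterion is sharp on the two cells -/

section SharpBoxes

variable {m n : ℕ} {S : List Face} {h : Face}

/-- **Placement under a two-cell defect list.** A reference block within the bounds avoiding the hole and two reference cells `c`, `d`
sits in `boxMinus m n S` for every `S` inside `{h, c + v, d + v}` (`v` the shift to the hole `h`), given the room.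
[cite: GlazmanManolescu2019, §2.1 (finite domains of faces), §4.2 (translation invariance)] -/
theorem block_hroot_subset_boxMinus_pair (B : List Face) (x0 x1 y0 y1 : ℤ) (c d : Face)
    (hB : ∀ a ∈ B, x0 ≤ a.1 ∧ a.1 ≤ x1 ∧ y0 ≤ a.2 ∧ a.2 ≤ y1 ∧ a ≠ (3, 2) ∧ a ≠ c ∧ a ≠ d)
    (hW : 3 ≤ x0 + h.1) (hE : x1 + h.1 ≤ m + 2) (hS : 2 ≤ y0 + h.2) (hN : y1 + h.2 ≤ n + 1)
    (hSn : ∀ s ∈ S, s = h ∨ s = (c.1 + (h.1 - 3), c.2 + (h.2 - 2)) ∨ s = (d.1 + (h.1 - 3), d.2 + (h.2 - 2))) :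
    ∀ e ∈ B.map (Face.shiftBy (refShift (h.1 + 1, h.2))), e ∈ boxMinus m n S := by
  intro e he
  rw [List.mem_map] at he
  obtain ⟨a, ha, rfl⟩ := he
  obtain ⟨b1, b2, b3, b4, b5, b6, b7⟩ := hB a ha
  obtain ⟨x, y⟩ := a
  obtain ⟨c1, c2⟩ := c
  obtain ⟨d1, d2⟩ := d
  simp only [ne_eq, Prod.mk.injEq, not_and] at b1 b2 b3 b4 b5 b6 b7
  rw [shiftBy_refShift_mk, mem_boxMinus]
  refine ⟨⟨by omega, by omega, by omega, by omega⟩, fun hs => ?_⟩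
  rcases hSn _ hs with e | e | e <;>
    (have e' := Prod.ext_iff.1 e; simp only at e'; omega)

/-- The far cell is none of the three cells `h`, `c + v`, `d + v` when `c`, `d` are not the reference far cell `(2, 2)`. [folklore]
[cite: GlazmanManolescu2019, §2.1 (finite domains of faces)] -/
theorem farCell_not_mem_pair (c d : Face) (hc : c ≠ (2, 2)) (hd : d ≠ (2, 2))
    (hSn : ∀ s ∈ S, s = h ∨ s = (c.1 + (h.1 - 3), c.2 + (h.2 - 2)) ∨ s = (d.1 + (h.1 - 3), d.2 + (h.2 - 2))) :
    ((h.1 - 1, h.2) : Face) ∉ S := by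
  intro hs
  obtain ⟨c1, c2⟩ := c
  obtain ⟨d1, d2⟩ := d
  simp only [ne_eq, Prod.mk.injEq, not_and] at hc hd
  rcases hSn _ hs with e | e | e <;>
    (have e' := Prod.ext_iff.1 e; simp only at e'; omega)

/-- The cells of `sharpBlockRK42`, in coordinates (decided on the list). [cite: GlazmanManolescu2019, §2.1 (finite domains of faces)] -/
theorem sharpBlockRK42_bounds : ∀ a ∈ sharpBlockRK42,
    1 ≤ a.1 ∧ a.1 ≤ 7 ∧ -2 ≤ a.2 ∧ a.2 ≤ 3 ∧ a ≠ (3, 2) ∧ a ≠ (4, 1) ∧ a ≠ (5, 0) := by decide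

/-- The cells of `sharpBlockHF42`, in coordinates. [cite: GlazmanManolescu2019, §2.1 (finite domains of faces)] -/
theorem sharpBlockHF42_bounds : ∀ a ∈ sharpBlockHF42,
    0 ≤ a.1 ∧ a.1 ≤ 5 ∧ -2 ≤ a.2 ∧ a.2 ≤ 3 ∧ a ≠ (3, 2) ∧ a ≠ (3, 1) ∧ a ≠ (2, 0) := by decide

/-- The cells of `sharpBlockRKN42`, in coordinates. [cite: GlazmanManolescu2019, §2.1 (finite domains of faces)] -/
theorem sharpBlockRKN42_bounds : ∀ a ∈ sharpBlockRKN42,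
    1 ≤ a.1 ∧ a.1 ≤ 7 ∧ 1 ≤ a.2 ∧ a.2 ≤ 6 ∧ a ≠ (3, 2) ∧ a ≠ (4, 3) ∧ a ≠ (5, 4) := by decide

/-- The cells of `sharpBlockHFN42`, in coordinates. [cite: GlazmanManolescu2019, §2.1 (finite domains of faces)] -/
theorem sharpBlockHFN42_bounds : ∀ a ∈ sharpBlockHFN42,
    0 ≤ a.1 ∧ a.1 ≤ 5 ∧ 1 ≤ a.2 ∧ a.2 ≤ 6 ∧ a ≠ (3, 2) ∧ a ≠ (3, 3) ∧ a ≠ (2, 4) := by decide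

/-- ★★★★★ **THE CUT CRITERION IS SHARP ON `{rootS, K_S1}`.** In the `m × n` box with `2 ≤ h.1`, `h.1 + 4 ≤ m`, `3 ≤ h.2`,
`h.2 + 2 ≤ n`, remove the hole `h`, the root notch `rootS = (h.1 + 1, h.2 − 1)` and the corner cell `K_S1 = (h.1 + 2, h.2 − 2)`
(`S ∋ h` any list inside the three-cell set containing both). Then: NO class-`B2a` under-walk at the far cell is wound ⟺ the floor is
EXACTLY three rows below the hole (`h.2 = 3`) OR the east wall is EXACTLY two columns beyond the root plaquette (`h.1 + 4 = m`) — the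
two one-live-edge cuts of the parent; in every other box the unmarked 34-arc witness `sharpBlockRK` fits.
[cite: GlazmanManolescu2019, Lemma 2.1 (statement, "in the form given in [Gl]"), §2.1, §4.2]
[cite: Glazman2015WeightedSAW, Lemma 3.1 (proof, pp. 6–7)] [cite: CourantRobbins1958, Ch. V Appendix §2 (the even–odd rule)] -/
theorem lawL_box_rootS_killSE_not_wound_under_iff (hW : 2 ≤ h.1) (hE : h.1 + 4 ≤ m) (hS : 3 ≤ h.2) (hN : h.2 + 2 ≤ n)
    (hh : h ∈ S) (hcS : ((h.1 + 1, h.2 - 1) : Face) ∈ S) (hcK : ((h.1 + 2, h.2 - 2) : Face) ∈ S)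
    (hSn : ∀ s ∈ S, s = h ∨ s = (h.1 + 1, h.2 - 1) ∨ s = (h.1 + 2, h.2 - 2))
    (hr : RootedFace (dom (boxMinus m n S)) (Face.side (h.1 + 1, h.2) .W) (farW (h.1 + 1, h.2))) (θ : ℝ) :
    (∀ (ω : ΩG (dom (boxMinus m n S)) (Face.side (h.1 + 1, h.2) .W) (farW (h.1 + 1, h.2))) (hb : ω.IsB2a),
        ω.2.firstSideG = .S → ω.WE (fun _ => θ) = excursionWinding θ ω.2.firstSideG (ω.z1 hr hb) ω.1) ↔
      (h.2 = 3 ∨ h.1 + 4 = m) := by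
  have hSn' : ∀ s ∈ S, s = h ∨ s = ((4 : ℤ) + (h.1 - 3), (1 : ℤ) + (h.2 - 2)) ∨ s = ((5 : ℤ) + (h.1 - 3), (0 : ℤ) + (h.2 - 2)) := by
    intro s hs
    rcases hSn s hs with e | e | e
    · exact Or.inl e
    · exact Or.inr (Or.inl (by rw [e]; exact Prod.ext (by simp only; ring) (by simp only; ring)))
    · exact Or.inr (Or.inr (by rw [e]; exact Prod.ext (by simp only; ring) (by simp only; ring)))
  have hfS : ((h.1 - 1, h.2) : Face) ∉ S := farCell_not_mem_pair (4, 1) (5, 0) (by decide) (by decide) hSn'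
  constructor
  · intro hall
    by_contra hgeo
    have h4 : 4 ≤ h.2 := by omega
    have h5 : h.1 + 5 ≤ m := by omega
    obtain ⟨ω, hb, hs, hw, -⟩ := exists_under_unmarked_of_sharpBlockRK
      (block_hroot_subset_boxMinus_pair sharpBlockRK42 1 7 (-2) 3 (4, 1) (5, 0) sharpBlockRK42_bounds
        (by omega) (by omega) (by omega) (by omega) hSn') hr θ
    exact hw (hall ω hb hs)
  · rintro (h3 | h4) ω hb hs
    · have hcS' : ((h.1 + 1, 2) : Face) ∈ S := by
        rw [show ((h.1 + 1, 2) : Face) = (h.1 + 1, h.2 - 1) from Prod.ext rfl (by simp only; omega)]; exact hcS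
      have hcK' : ((h.1 + 2, 1) : Face) ∈ S := by
        rw [show ((h.1 + 2, 1) : Face) = (h.1 + 2, h.2 - 2) from Prod.ext rfl (by simp only; omega)]; exact hcK
      exact lawL_box_rootS_killSE_h3_not_wound_under (by omega) (by omega) h3 (by omega) hh hfS hcS' hcK' ω hb hs θ
    · exact lawL_box_rootS_killSE_eastCol_not_wound_under (by omega) h4 (by omega) (by omega) hh hfS hcS hcK ω hb hs θ

/-- ★★★★★ **THE CUT CRITERION IS SHARP ON `{holeS, farSWS}`.** In the `m × n` box with `2 ≤ h.1`, `h.1 + 3 ≤ m`, `3 ≤ h.2`,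
`h.2 + 2 ≤ n`, remove the hole `h`, `holeS = (h.1, h.2 − 1)` and the cell two below the far cell `(h.1 − 1, h.2 − 2)` (`S ∋ h` any
list inside the three-cell set containing both). Then: NO class-`B2a` under-walk at the far cell is wound ⟺ `h.2 = 3` (floor three
rows below) OR `h.1 = 2` (west wall right behind `farWW`, §1); otherwise the unmarked 32-arc witness `sharpBlockHF` fits.
[cite: GlazmanManolescu2019, Lemma 2.1 (statement, "in the form given in [Gl]"), §2.1, §4.2]
[cite: Glazman2015WeightedSAW, Lemma 3.1 (proof, pp. 6–7)] [cite: CourantRobbins1958, Ch. V Appendix §2 (the even–odd rule)] -/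
theorem lawL_box_holeS_farSWS_not_wound_under_iff (hW : 2 ≤ h.1) (hE : h.1 + 3 ≤ m) (hS : 3 ≤ h.2) (hN : h.2 + 2 ≤ n)
    (hh : h ∈ S) (hcH : ((h.1, h.2 - 1) : Face) ∈ S) (hcF : ((h.1 - 1, h.2 - 2) : Face) ∈ S)
    (hSn : ∀ s ∈ S, s = h ∨ s = (h.1, h.2 - 1) ∨ s = (h.1 - 1, h.2 - 2))
    (hr : RootedFace (dom (boxMinus m n S)) (Face.side (h.1 + 1, h.2) .W) (farW (h.1 + 1, h.2))) (θ : ℝ) :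
    (∀ (ω : ΩG (dom (boxMinus m n S)) (Face.side (h.1 + 1, h.2) .W) (farW (h.1 + 1, h.2))) (hb : ω.IsB2a),
        ω.2.firstSideG = .S → ω.WE (fun _ => θ) = excursionWinding θ ω.2.firstSideG (ω.z1 hr hb) ω.1) ↔
      (h.2 = 3 ∨ h.1 = 2) := by
  have hSn' : ∀ s ∈ S, s = h ∨ s = ((3 : ℤ) + (h.1 - 3), (1 : ℤ) + (h.2 - 2)) ∨ s = ((2 : ℤ) + (h.1 - 3), (0 : ℤ) + (h.2 - 2)) := by
    intro s hs
    rcases hSn s hs with e | e | e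
    · exact Or.inl e
    · exact Or.inr (Or.inl (by rw [e]; exact Prod.ext (by simp only; ring) (by simp only; ring)))
    · exact Or.inr (Or.inr (by rw [e]; exact Prod.ext (by simp only; ring) (by simp only; ring)))
  have hfS : ((h.1 - 1, h.2) : Face) ∉ S := farCell_not_mem_pair (3, 1) (2, 0) (by decide) (by decide) hSn'
  constructor
  · intro hall
    by_contra hgeo
    have h4 : 4 ≤ h.2 := by omega
    have h3 : 3 ≤ h.1 := by omega
    obtain ⟨ω, hb, hs, hw, -⟩ := exists_under_unmarked_of_sharpBlockHF
      (block_hroot_subset_boxMinus_pair sharpBlockHF42 0 5 (-2) 3 (3, 1) (2, 0) sharpBlockHF42_bounds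
        (by omega) (by omega) (by omega) (by omega) hSn') hr θ
    exact hw (hall ω hb hs)
  · rintro (h3 | h2) ω hb hs
    · have hcH' : ((h.1, 2) : Face) ∈ S := by
        rw [show ((h.1, 2) : Face) = (h.1, h.2 - 1) from Prod.ext rfl (by simp only; omega)]; exact hcH
      have hcF' : ((h.1 - 1, 1) : Face) ∈ S := by
        rw [show ((h.1 - 1, 1) : Face) = (h.1 - 1, h.2 - 2) from Prod.ext rfl (by simp only; omega)]; exact hcF
      exact lawL_box_holeS_farSWS_h3_not_wound_under (by omega) (by omega) h3 (by omega) hh hfS hcH' hcF' ω hb hs θ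
    · exact lawL_box_holeS_farSWS_westCol_not_wound_under h2 (by omega) (by omega) (by omega) hh hfS hcH hcF ω hb hs θ

/-- ★★★★★ **TWIN: THE CUT CRITERION IS SHARP ON `{rootN, K_N2}`.** `2 ≤ h.1`, `h.1 + 4 ≤ m`, `1 ≤ h.2`, `h.2 + 4 ≤ n`; `S ∋ h`
inside `{h, rootN = (h.1 + 1, h.2 + 1), K_N2 = (h.1 + 2, h.2 + 2)}` containing both: NO wound class-`B2a` OVER-walk ⟺ `h.2 + 4 = n`
(ceiling three rows above) OR `h.1 + 4 = m`.
[cite: GlazmanManolescu2019, Lemma 2.1 (statement, "in the form given in [Gl]"), §2.1, §4.2]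
[cite: Glazman2015WeightedSAW, Lemma 3.1 (proof, pp. 6–7)] [cite: CourantRobbins1958, Ch. V Appendix §2 (the even–odd rule)] -/
theorem lawL_box_rootN_killNE_not_wound_over_iff (hW : 2 ≤ h.1) (hE : h.1 + 4 ≤ m) (hS : 1 ≤ h.2) (hN : h.2 + 4 ≤ n)
    (hh : h ∈ S) (hcN : ((h.1 + 1, h.2 + 1) : Face) ∈ S) (hcK : ((h.1 + 2, h.2 + 2) : Face) ∈ S)
    (hSn : ∀ s ∈ S, s = h ∨ s = (h.1 + 1, h.2 + 1) ∨ s = (h.1 + 2, h.2 + 2))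
    (hr : RootedFace (dom (boxMinus m n S)) (Face.side (h.1 + 1, h.2) .W) (farW (h.1 + 1, h.2))) (θ : ℝ) :
    (∀ (ω : ΩG (dom (boxMinus m n S)) (Face.side (h.1 + 1, h.2) .W) (farW (h.1 + 1, h.2))) (hb : ω.IsB2a),
        ω.2.firstSideG = .N → ω.WE (fun _ => θ) = excursionWinding θ ω.2.firstSideG (ω.z1 hr hb) ω.1) ↔
      (h.2 + 4 = n ∨ h.1 + 4 = m) := by
  have hSn' : ∀ s ∈ S, s = h ∨ s = ((4 : ℤ) + (h.1 - 3), (3 : ℤ) + (h.2 - 2)) ∨ s = ((5 : ℤ) + (h.1 - 3), (4 : ℤ) + (h.2 - 2)) := by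
    intro s hs
    rcases hSn s hs with e | e | e
    · exact Or.inl e
    · exact Or.inr (Or.inl (by rw [e]; exact Prod.ext (by simp only; ring) (by simp only; ring)))
    · exact Or.inr (Or.inr (by rw [e]; exact Prod.ext (by simp only; ring) (by simp only; ring)))
  have hfS : ((h.1 - 1, h.2) : Face) ∉ S := farCell_not_mem_pair (4, 3) (5, 4) (by decide) (by decide) hSn'
  constructor
  · intro hall
    by_contra hgeo
    have h5 : h.2 + 5 ≤ n := by omega
    have h5' : h.1 + 5 ≤ m := by omega
    obtain ⟨ω, hb, hs, hw, -⟩ := exists_over_unmarked_of_sharpBlockRKN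
      (block_hroot_subset_boxMinus_pair sharpBlockRKN42 1 7 1 6 (4, 3) (5, 4) sharpBlockRKN42_bounds
        (by omega) (by omega) (by omega) (by omega) hSn') hr θ
    exact hw (hall ω hb hs)
  · rintro (h4 | h4) ω hb hs
    · exact lawL_box_rootN_killNE_n4_not_wound_over (by omega) (by omega) (by omega) h4 hh hfS hcN hcK ω hb hs θ
    · exact lawL_box_rootN_killNE_eastCol_not_wound_over (by omega) h4 (by omega) (by omega) hh hfS hcN hcK ω hb hs θ

/-- ★★★★★ **TWIN: THE CUT CRITERION IS SHARP ON `{holeN, farNWN}`.** `2 ≤ h.1`, `h.1 + 3 ≤ m`, `1 ≤ h.2`, `h.2 + 4 ≤ n`; `S ∋ h`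
inside `{h, holeN = (h.1, h.2 + 1), (h.1 − 1, h.2 + 2)}` containing both: NO wound class-`B2a` OVER-walk ⟺ `h.2 + 4 = n` OR `h.1 = 2`.
[cite: GlazmanManolescu2019, Lemma 2.1 (statement, "in the form given in [Gl]"), §2.1, §4.2]
[cite: Glazman2015WeightedSAW, Lemma 3.1 (proof, pp. 6–7)] [cite: CourantRobbins1958, Ch. V Appendix §2 (the even–odd rule)] -/
theorem lawL_box_holeN_farNWN_not_wound_over_iff (hW : 2 ≤ h.1) (hE : h.1 + 3 ≤ m) (hS : 1 ≤ h.2) (hN : h.2 + 4 ≤ n)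
    (hh : h ∈ S) (hcH : ((h.1, h.2 + 1) : Face) ∈ S) (hcF : ((h.1 - 1, h.2 + 2) : Face) ∈ S)
    (hSn : ∀ s ∈ S, s = h ∨ s = (h.1, h.2 + 1) ∨ s = (h.1 - 1, h.2 + 2))
    (hr : RootedFace (dom (boxMinus m n S)) (Face.side (h.1 + 1, h.2) .W) (farW (h.1 + 1, h.2))) (θ : ℝ) :
    (∀ (ω : ΩG (dom (boxMinus m n S)) (Face.side (h.1 + 1, h.2) .W) (farW (h.1 + 1, h.2))) (hb : ω.IsB2a),
        ω.2.firstSideG = .N → ω.WE (fun _ => θ) = excursionWinding θ ω.2.firstSideG (ω.z1 hr hb) ω.1) ↔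
      (h.2 + 4 = n ∨ h.1 = 2) := by
  have hSn' : ∀ s ∈ S, s = h ∨ s = ((3 : ℤ) + (h.1 - 3), (3 : ℤ) + (h.2 - 2)) ∨ s = ((2 : ℤ) + (h.1 - 3), (4 : ℤ) + (h.2 - 2)) := by
    intro s hs
    rcases hSn s hs with e | e | e
    · exact Or.inl e
    · exact Or.inr (Or.inl (by rw [e]; exact Prod.ext (by simp only; ring) (by simp only; ring)))
    · exact Or.inr (Or.inr (by rw [e]; exact Prod.ext (by simp only; ring) (by simp only; ring)))
  have hfS : ((h.1 - 1, h.2) : Face) ∉ S := farCell_not_mem_pair (3, 3) (2, 4) (by decide) (by decide) hSn'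
  constructor
  · intro hall
    by_contra hgeo
    have h5 : h.2 + 5 ≤ n := by omega
    have h3 : 3 ≤ h.1 := by omega
    obtain ⟨ω, hb, hs, hw, -⟩ := exists_over_unmarked_of_sharpBlockHFN
      (block_hroot_subset_boxMinus_pair sharpBlockHFN42 0 5 1 6 (3, 3) (2, 4) sharpBlockHFN42_bounds
        (by omega) (by omega) (by omega) (by omega) hSn') hr θ
    exact hw (hall ω hb hs)
  · rintro (h4 | h2) ω hb hs
    · exact lawL_box_holeN_farNWN_n4_not_wound_over (by omega) (by omega) (by omega) h4 hh hfS hcH hcF ω hb hs θ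
    · exact lawL_box_holeN_farNWN_westCol_not_wound_over h2 (by omega) (by omega) (by omega) hh hfS hcH hcF ω hb hs θ

/-- ★★★ **COROLLARY: OFF THE TWO WALLS NEITHER HONEYCOMB KILL HOLDS ON `{rootS, K_S1}`** — with `4 ≤ h.2` and `h.1 + 5 ≤ m` (and the
room of the biconditional) the under route carries a wound walk that is `w₁`-free AND `w₂`-free off the far cell.
[cite: GlazmanManolescu2019, §1 (Fig. 2 and the remark after eq. (1)), §2.1, §4.2, Lemma 2.1]
[cite: Glazman2015WeightedSAW, Lemma 3.1 (proof, pp. 6–7)] [cite: CourantRobbins1958, Ch. V Appendix §2 (the even–odd rule)] -/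
theorem lawL_box_rootS_killSE_exists_under_unmarked (hW : 2 ≤ h.1) (hE : h.1 + 5 ≤ m) (hS : 4 ≤ h.2) (hN : h.2 + 2 ≤ n)
    (hSn : ∀ s ∈ S, s = h ∨ s = (h.1 + 1, h.2 - 1) ∨ s = (h.1 + 2, h.2 - 2))
    (hr : RootedFace (dom (boxMinus m n S)) (Face.side (h.1 + 1, h.2) .W) (farW (h.1 + 1, h.2))) (θ : ℝ) :
    ∃ (ω : ΩG (dom (boxMinus m n S)) (Face.side (h.1 + 1, h.2) .W) (farW (h.1 + 1, h.2))) (hb : ω.IsB2a),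
      ω.2.firstSideG = .S ∧ ω.WE (fun _ => θ) ≠ excursionWinding θ ω.2.firstSideG (ω.z1 hr hb) ω.1 ∧
        (ω.2.W1FreeOff (farW (h.1 + 1, h.2)) ∧ ω.2.W2FreeOff (farW (h.1 + 1, h.2))) := by
  have hSn' : ∀ s ∈ S, s = h ∨ s = ((4 : ℤ) + (h.1 - 3), (1 : ℤ) + (h.2 - 2)) ∨ s = ((5 : ℤ) + (h.1 - 3), (0 : ℤ) + (h.2 - 2)) := by
    intro s hs
    rcases hSn s hs with e | e | e
    · exact Or.inl e
    · exact Or.inr (Or.inl (by rw [e]; exact Prod.ext (by simp only; ring) (by simp only; ring)))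
    · exact Or.inr (Or.inr (by rw [e]; exact Prod.ext (by simp only; ring) (by simp only; ring)))
  exact exists_under_unmarked_of_sharpBlockRK
    (block_hroot_subset_boxMinus_pair sharpBlockRK42 1 7 (-2) 3 (4, 1) (5, 0) sharpBlockRK42_bounds
      (by omega) (by omega) (by omega) (by omega) hSn') hr θ

/-- ★★★ **COROLLARY: NEITHER HONEYCOMB KILL HOLDS ON `{holeS, farSWS}` OFF THE FLOOR AND THE WEST WALL** (`3 ≤ h.1`, `4 ≤ h.2`).
[cite: GlazmanManolescu2019, §1 (Fig. 2 and the remark after eq. (1)), §2.1, §4.2, Lemma 2.1]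
[cite: Glazman2015WeightedSAW, Lemma 3.1 (proof, pp. 6–7)] [cite: CourantRobbins1958, Ch. V Appendix §2 (the even–odd rule)] -/
theorem lawL_box_holeS_farSWS_exists_under_unmarked (hW : 3 ≤ h.1) (hE : h.1 + 3 ≤ m) (hS : 4 ≤ h.2) (hN : h.2 + 2 ≤ n)
    (hSn : ∀ s ∈ S, s = h ∨ s = (h.1, h.2 - 1) ∨ s = (h.1 - 1, h.2 - 2))
    (hr : RootedFace (dom (boxMinus m n S)) (Face.side (h.1 + 1, h.2) .W) (farW (h.1 + 1, h.2))) (θ : ℝ) :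
    ∃ (ω : ΩG (dom (boxMinus m n S)) (Face.side (h.1 + 1, h.2) .W) (farW (h.1 + 1, h.2))) (hb : ω.IsB2a),
      ω.2.firstSideG = .S ∧ ω.WE (fun _ => θ) ≠ excursionWinding θ ω.2.firstSideG (ω.z1 hr hb) ω.1 ∧
        (ω.2.W1FreeOff (farW (h.1 + 1, h.2)) ∧ ω.2.W2FreeOff (farW (h.1 + 1, h.2))) := by
  have hSn' : ∀ s ∈ S, s = h ∨ s = ((3 : ℤ) + (h.1 - 3), (1 : ℤ) + (h.2 - 2)) ∨ s = ((2 : ℤ) + (h.1 - 3), (0 : ℤ) + (h.2 - 2)) := by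
    intro s hs
    rcases hSn s hs with e | e | e
    · exact Or.inl e
    · exact Or.inr (Or.inl (by rw [e]; exact Prod.ext (by simp only; ring) (by simp only; ring)))
    · exact Or.inr (Or.inr (by rw [e]; exact Prod.ext (by simp only; ring) (by simp only; ring)))
  exact exists_under_unmarked_of_sharpBlockHF
    (block_hroot_subset_boxMinus_pair sharpBlockHF42 0 5 (-2) 3 (3, 1) (2, 0) sharpBlockHF42_bounds
      (by omega) (by omega) (by omega) (by omega) hSn') hr θ

end SharpBoxes

end Literature.Barriers.CriticalPhenomena.PlaquetteWalk
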